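import Summits.CriticalPhenomena.CardyFormulaZ2.Theorems.HalfPlaneMarkDensityLaw.Negative.MarkEvents
import Literature.Probability.Percolation.Z2HalfPlaneInterlace

/-!
# Self-duality of the half-plane arc-crossing function of bond-`ℤ²`, part 5b: walk surgery

Support file for the crux `HalfPlaneMarkDensityLaw` (stmt-CriticalPhenomena-5661), line `Sketch`
(a-priori structure of the open stub C⁺: self-duality, Stage II — bottom-row insensitivity).
Lattice-walk tools for the three-arm extraction (part 5c):

* `exists_prefix_sat` — the initial segment of a walk up to its first vertex with a given property;
* `exists_leftRun` — the straight walk to the left;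
* `exists_escape` — from a site `(c, y₀)`, `y₀ ≥ 0`, an ESCAPE walk going up to height `h`, left to
  the column `x₀ ≤ c` and down that column to depth `-2`, together with its winding number:
  it does not wind around any moat face `(k,-1)` with `k ≥ x₀` (its only steps across the line
  `x₁ = -½` are on the column `x₀`, weakly left of the face);
* `walkWinding_legged` — the winding number of the loop-like walk "leg up at `a`, a walk of the
  half-plane, an escape" around the moat face `(k,-1)`, `k ≥ x₀`, is `[k < a]`.
-/

noncomputable section

namespace Summit.CriticalPhenomena.CardyFormulaZ2.Cruxes.HalfPlaneMarkDensityLaw.SketchLine.SelfDual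

open Literature.Probability.Percolation Literature.Probability.LatticeModels
open Literature.Probability.Percolation.Z2HalfPlane (leg adj_leg)
open MeasureTheory Filter Set SimpleGraph
open Summit.CriticalPhenomena.CardyFormulaZ2.Theorems.HalfPlaneMarkDensityLaw.Negative

/-! ### First vertex with a property -/

/-- **Initial segment up to the first vertex with property `Pr`.**  If the last vertex of a walk
satisfies `Pr`, the walk has an initial segment ending at a vertex satisfying `Pr` all of whose
earlier vertices do not; its darts and vertices are darts and vertices of the walk. [folklore] -/
theorem exists_prefix_sat {V : Type*} {G : SimpleGraph V} (Pr : V → Prop) [DecidablePred Pr]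
    {x y : V} (p : G.Walk x y) (hy : Pr y) :
    ∃ (z : V) (q : G.Walk x z), Pr z ∧ (∀ d ∈ q.darts, ¬ Pr d.fst) ∧
      (∀ d ∈ q.darts, d ∈ p.darts) ∧ (∀ v ∈ q.support, v ∈ p.support) := by
  induction p with
  | nil => exact ⟨_, Walk.nil, hy, by simp, by simp, by simp⟩
  | cons h p ih =>
    rename_i a b c
    by_cases ha : Pr a
    · exact ⟨a, Walk.nil, ha, by simp, by simp, by simp⟩
    · obtain ⟨z, q, hz, hq, hd, hs⟩ := ih hy
      refine ⟨z, Walk.cons h q, hz, ?_, ?_, ?_⟩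
      · intro d hd'
        rw [Walk.darts_cons, List.mem_cons] at hd'
        rcases hd' with rfl | hd'
        · exact ha
        · exact hq d hd'
      · intro d hd'
        rw [Walk.darts_cons, List.mem_cons] at hd' ⊢
        rcases hd' with rfl | hd'
        · exact Or.inl rfl
        · exact Or.inr (hd d hd')
      · intro v hv
        rw [Walk.support_cons, List.mem_cons] at hv ⊢
        rcases hv with rfl | hv
        · exact Or.inl rfl
        · exact Or.inr (hs v hv)

/-! ### Straight walks -/

/-- The straight walk of `n` steps to the LEFT from `(c, y)`. [folklore] -/
theorem exists_leftRun (c y : ℤ) (n : ℕ) :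
    ∃ L : (zdGraph 2).Walk (![c, y] : Site 2) ![c - n, y],
      ∀ w ∈ L.support, w 1 = y ∧ c - n ≤ w 0 ∧ w 0 ≤ c := by
  induction n generalizing c with
  | zero =>
    refine ⟨(Walk.nil : (zdGraph 2).Walk (![c, y] : Site 2) ![c, y]).copy rfl (by simp), ?_⟩
    intro w hw
    rw [Walk.support_copy, Walk.support_nil, List.mem_singleton] at hw
    subst hw; simp
  | succ n ih =>
    obtain ⟨L, hL⟩ := ih (c - 1)
    have hadj : (zdGraph 2).Adj (![c, y] : Site 2) ![c - 1, y] :=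
      adj_of_stepKind (.left (by simp) (by simp))
    have he : (![c - 1 - n, y] : Site 2) = ![c - (n + 1 : ℕ), y] := by
      ext i; fin_cases i <;> simp; ring
    refine ⟨(Walk.cons hadj L).copy rfl he, ?_⟩
    intro w hw
    rw [Walk.support_copy, Walk.support_cons, List.mem_cons] at hw
    rcases hw with rfl | hw
    · simp; omega
    · have := hL w hw; push_cast; omega

/-! ### The escape walk and its winding -/

/-- **The escape walk.**  From `(c, y₀)` with `0 ≤ y₀ ≤ h` and `x₀ ≤ c`: straight up to height `h`,
left along the row `h` to the column `x₀`, down the column `x₀` to depth `-2`.  Its vertices lie on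
these three segments, and it does not wind around any moat face `(k,-1)` with `x₀ ≤ k`.
[folklore] -/
theorem exists_escape (c y₀ x₀ h : ℤ) (hx : x₀ ≤ c) (hy : 0 ≤ y₀) (hyh : y₀ ≤ h) :
    ∃ E : (zdGraph 2).Walk (![c, y₀] : Site 2) ![x₀, -2],
      (∀ z ∈ E.support, (z 0 = c ∧ y₀ ≤ z 1 ∧ z 1 ≤ h) ∨ (z 1 = h ∧ x₀ ≤ z 0 ∧ z 0 ≤ c) ∨
        (z 0 = x₀ ∧ -2 ≤ z 1 ∧ z 1 ≤ h)) ∧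
      ∀ u : Site 2, u 1 = -1 → x₀ ≤ u 0 → walkWinding E u = 0 := by
  -- the three runs
  obtain ⟨V, hV⟩ := Z2HalfPlane.exists_upRun c y₀ (h - y₀).toNat
  have hVend : (![c, y₀ + ((h - y₀).toNat : ℕ)] : Site 2) = ![c, h] := by
    have : (((h - y₀).toNat : ℕ) : ℤ) = h - y₀ := Int.toNat_of_nonneg (by omega)
    ext i; fin_cases i <;> simp [this]
  obtain ⟨L, hL⟩ := exists_leftRun c h (c - x₀).toNat
  have hLend : (![c - ((c - x₀).toNat : ℕ), h] : Site 2) = ![x₀, h] := by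
    have : (((c - x₀).toNat : ℕ) : ℤ) = c - x₀ := Int.toNat_of_nonneg (by omega)
    ext i; fin_cases i <;> simp [this]
  set D := downRun (![x₀, h] : Site 2) (h + 2).toNat with hD
  have hDend : ((fun w : Site 2 => w - Pi.single 1 1)^[(h + 2).toNat] (![x₀, h] : Site 2)) = ![x₀, -2] := by
    have : (((h + 2).toNat : ℕ) : ℤ) = h + 2 := Int.toNat_of_nonneg (by omega)
    ext i; fin_cases i
    · simp
    · simp [this]
  refine ⟨(V.copy rfl hVend).append ((L.copy rfl hLend).append (D.copy rfl hDend)), ?_, ?_⟩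
  · intro z hz
    simp only [Walk.mem_support_append_iff, Walk.support_copy] at hz
    rcases hz with hz | hz | hz
    · have := hV z hz
      have h1 : (((h - y₀).toNat : ℕ) : ℤ) = h - y₀ := Int.toNat_of_nonneg (by omega)
      rw [h1] at this
      exact Or.inl ⟨this.1, this.2.1, by omega⟩
    · have := hL z hz
      have h1 : (((c - x₀).toNat : ℕ) : ℤ) = c - x₀ := Int.toNat_of_nonneg (by omega)
      rw [h1] at this
      exact Or.inr (Or.inl ⟨this.1, by omega, this.2.2⟩)
    · rw [hD] at hz
      obtain ⟨hz0, hzlo, hzhi⟩ := mem_support_downRun.1 hz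
      have h1 : (((h + 2).toNat : ℕ) : ℤ) = h + 2 := Int.toNat_of_nonneg (by omega)
      simp only [Matrix.cons_val_zero, Matrix.cons_val_one, Matrix.cons_val_fin_one, h1] at hz0 hzlo hzhi
      exact Or.inr (Or.inr ⟨hz0, by omega, hzhi⟩)
  · intro u hu1 hu0
    rw [walkWinding_append, walkWinding_append, Z2HalfPlane.walkWinding_copy, Z2HalfPlane.walkWinding_copy,
      Z2HalfPlane.walkWinding_copy]
    have h1 : walkWinding V u = 0 :=
      walkWinding_eq_zero_of_ge (L := 0) (fun z hz => by have := (hV z hz).2.1; omega) (by omega)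
    have h2 : walkWinding L u = 0 :=
      walkWinding_eq_zero_of_ge (L := 0) (fun z hz => by have := (hL z hz).1; omega) (by omega)
    have h3 : walkWinding D u = 0 := by
      refine Z2HalfPlane.walkWinding_eq_zero_of_right fun z hz => ?_
      rw [hD] at hz
      have hz0 := (mem_support_downRun.1 hz).1
      simp only [Matrix.cons_val_zero] at hz0
      omega
    rw [h1, h2, h3]; ring

/-- **Winding of leg–walk–escape.**  Let `a, k ≥ x₀`, `γ` a walk of the half-plane (heights `≥ 0`)
from `(a,0)` to `u`, `u ∼ w` a lattice step between sites of height `≥ 0`, and `E` an escape walk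
from `w` that does not wind around moat faces right of `x₀`.  Then the walk
`(a,-1) → (a,0) —γ→ u → w —E→` winds `[k < a]` times around the moat face `(k,-1)`: its only
step across the line `x₁ = -½` to the right of the face is the leg, counted iff `k + 1 ≤ a`.
[cite: WernerPCMI2009, Lecture 2, first exercise sheet ("Two-arm exponent in the half-plane", 2b)] -/
theorem walkWinding_legged {a k : ℤ} {u w b : Site 2} (γ : (zdGraph 2).Walk (![a, 0] : Site 2) u)
    (hγ : ∀ z ∈ γ.support, 0 ≤ z 1) (huw : (zdGraph 2).Adj u w) (hw : 0 ≤ w 1)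
    (E : (zdGraph 2).Walk w b) (hE : walkWinding E ![k, -1] = 0) :
    walkWinding (Walk.cons (adj_leg a) (γ.append (Walk.cons huw E))) ![k, -1] =
      if k + 1 ≤ a then 1 else 0 := by
  rw [walkWinding_cons, walkWinding_append, walkWinding_cons, hE]
  have hu : 0 ≤ u 1 := hγ u γ.end_mem_support
  have h1 : stepWinding ![k, -1] ![a, -1] ![a, 0] = if k + 1 ≤ a then 1 else 0 := by
    unfold stepWinding upStep
    by_cases hka : k + 1 ≤ a <;> simp [hka]
  have h2 : walkWinding γ ![k, -1] = 0 :=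
    walkWinding_eq_zero_of_ge (L := 0) (fun z hz => hγ z hz) (by simp)
  have h3 : stepWinding ![k, -1] u w = 0 := by
    have h := walkWinding_eq_zero_of_ge (p := Walk.cons huw Walk.nil) (u := ![k, -1]) (L := 0)
      (fun z hz => by
        rw [Walk.support_cons, Walk.support_nil, List.mem_cons, List.mem_singleton] at hz
        rcases hz with rfl | rfl
        · exact hu
        · exact hw) (by simp)
    simpa using h
  rw [h1, h2, h3]; ring

/-- **The escape walk, registered form** of `exists_escape`. [folklore] -/
theorem escape_walk : ∀ (c y₀ x₀ h : ℤ), x₀ ≤ c → 0 ≤ y₀ → y₀ ≤ h → ∃ E : (zdGraph 2).Walk (![c, y₀] : Site 2) ![x₀, -2], (∀ z ∈ E.support, (z 0 = c ∧ y₀ ≤ z 1 ∧ z 1 ≤ h) ∨ (z 1 = h ∧ x₀ ≤ z 0 ∧ z 0 ≤ c) ∨ (z 0 = x₀ ∧ -2 ≤ z 1 ∧ z 1 ≤ h)) ∧ ∀ u : Site 2, u 1 = -1 → x₀ ≤ u 0 → walkWinding E u = 0 :=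
  fun c y₀ x₀ h hx hy hyh => exists_escape c y₀ x₀ h hx hy hyh

end Summit.CriticalPhenomena.CardyFormulaZ2.Cruxes.HalfPlaneMarkDensityLaw.SketchLine.SelfDual
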